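import Summits.BirchSwinnertonDyer.BirchSwinnertonDyer.Theorems.ByReductionTypeAtTwoRankOneAtTwoBigImageOddLocalOneDoorHalvesBookkeeping
import Summits.BirchSwinnertonDyer.BirchSwinnertonDyer.Theorems.ByReductionTypeAtTwoRankOneAtTwoBigImageOddLocalOneDoorHalvesSlice
import HarnessLib

/-!
# Route ByReductionTypeAtTwo, crux `RankOneAtTwoBigImageOddLocal` (stmt-BirchSwinnertonDyer-23715), LINE v8.6 `one_door_analytic`:
# the two NAMED halves AN-28c-U / AN-28c-L are EXACTLY the two halves of `BSD₂` on the slice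

Lead prover seat `bsd-line-fkl-p1` g8 (2026-08-28), `--supports stmt-BirchSwinnertonDyer-23715`.  THEOREMS ONLY; nothing is asserted;
conditional by design; BSD is not proved by any of this.  Integration of the width seat fkl-p2 g8's `…OneDoorHalvesSlice.lean` (one-sided
door laws as displayed hypotheses `hGe` / `hLe`, «`∃ m`, exponent `∧` inequality») with the skeleton's registered stub statements
`DoorIndexLawUpperCAtTwo` / `DoorIndexLawLowerCAtTwo` (`…OneDoorLawCDefs.lean` APPEND #6, p626076; «`∀ m`, exponent `→` inequality»).
The two shapes agree because the exponent exists and is unique at every door datum (`exists_unique_exponent_at_door`,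
`…OneDoorHalvesBookkeeping.lean` p627433).  Modulo the four PRIMARY printed facts (`gross_zagier`, `kolyvagin`, `exists_isNewformOf`,
Hoffstein–Luo 1997) and rank-`0` `BSD₂` of the non-CM twin (`S_rankZeroTwin`, i.e. the route's four rank-`0` cruxes):

* §1 `doorLawGeC_of_doorIndexLawUpperCAtTwo` / `doorLawLeC_of_doorIndexLawLowerCAtTwo` — the named `∀ m` halves give the width seat's
  `∃ m` halves.
* §2 **`missingUpperBoundAt_two_onSlice_of_doorIndexLawUpperCAtTwo`** — AN-28c-U ⟹ `Typed.MissingUpperBoundAt W 2` (the Euler-system half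
  `ord₂ #Ш(W) ≤ ord₂ #Ш_an(W)`) for EVERY `W` on the slice; **`missingLowerBoundAt_two_onSlice_of_doorIndexLawLowerCAtTwo`** — AN-28c-L ⟹
  `Typed.MissingLowerBoundAt W 2` on the slice; **`shaAnTwoIntegralOnBigImageSlice_of_doorIndexLawUpperCAtTwo`** — the old fkl line's open
  residue (5b) `RankOneAtTwoFkl.ShaAnTwoIntegralOnBigImageSlice` BY NAME under AN-28c-U.
* §3 **losslessness on the slice**: `doorIndexLawUpperCAtTwo_of_missingUpperBoundAt_onSlice` / `doorIndexLawLowerCAtTwo_of_missingLowerBoundAt_onSlice`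
  and the two iffs `doorIndexLawUpperCAtTwo_iff_missingUpperBoundAt_onSlice` / `doorIndexLawLowerCAtTwo_iff_missingLowerBoundAt_onSlice`:
  **AN-28c-U ⟺ the Euler-system half of `BSD₂` on the whole slice, AN-28c-L ⟺ the main-conjecture half** — so the skeleton's two
  conjecture stubs are exactly Miller's two halves of `BSD(E,2)` for the curves of 23715, nothing more and nothing less.

References: [GrossLMS1991] Thm. 1.3, §2 Conj. (2.2); [Miller2011LMS] Def. 1.1; [Kolyvagin1990] Thm. A.
-/

set_option autoImplicit false

noncomputable section

open scoped Classical

set_option linter.dupNamespace false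

namespace Summit.BirchSwinnertonDyer.BirchSwinnertonDyer.Theorems.RankOneAtTwoOneDoor

open WeierstrassCurve NumberField IsDedekindDomain Rat.HeightOneSpectrum Literature.NumberTheory.EllipticCurves
  Literature.NumberTheory.EllipticCurves.ModularForms
  Literature.NumberTheory.EllipticCurves.KrizLi2019
  Literature.NumberTheory.EllipticCurves.Rank1Residual.Typed
  Summit.BirchSwinnertonDyer.Rank1Residual.F1Sign2
  Summit.BirchSwinnertonDyer.Rank1Residual.F1Sign2.TranspositionDoor
  Summit.BirchSwinnertonDyer.Rank1Residual
  Summit.BirchSwinnertonDyer.BirchSwinnertonDyer.Theses.ByReductionTypeAtTwo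
  Summit.BirchSwinnertonDyer.BirchSwinnertonDyer.Theorems.RankOneAtTwoFkl

/-! ### §1 The named `∀ m` halves give the width seat's `∃ m` halves (existence of the exponent) -/

/-- **AN-28c-U ⟹ AN-28c(≥) in the width seat's `∃ m` shape**: the exponent exists at every door datum (Gross–Zagier, Kolyvagin, the entire
continuation), and the named half bounds it. Conditional by design. [cite: GrossLMS1991, Thm. 1.3] -/
theorem doorLawGeC_of_doorIndexLawUpperCAtTwo
    (hGZ : ∀ (N : ℕ) [NeZero N] (W : WeierstrassCurve ℚ) (K : Type) [Field K] [NumberField K], gross_zagier N W K)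
    (hKo : ∀ (N : ℕ) [NeZero N] (W : WeierstrassCurve ℚ) (K : Type) [Field K] [NumberField K], kolyvagin N W K)
    (hnf : exists_isNewformOf) (hU : DoorIndexLawUpperCAtTwo) :
    ∀ (W : WeierstrassCurve ℚ) [W.IsElliptic] [W.IsGloballyMinimal] [NeZero (W.conductorNorm ℤ)],
      ¬ W.HasCM → (∀ n : ℕ, W.HasSurjectiveModNGaloisRep ((2 ^ n : ℕ) : ℤ)) → Odd W.torsionOrder → Odd W.tamagawaProduct →
      W.analyticRank = 1 →
      ∀ (K : Type) [Field K] [NumberField K], IsImaginaryQuadratic K → DoorAdmissible W (NumberField.discr K) →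
        (W.quadraticTwist (NumberField.discr K : ℚ)).entireLFunction 1 ≠ 0 →
        ∀ (Dt : ModularParametrizationData W (W.conductorNorm ℤ)) (H : HeegnerDatum (W.conductorNorm ℤ) (NumberField.discr K))
          (ι : K →+* ℂ) (P : (W.baseChange K).toAffine.Point),
          WeierstrassCurve.Affine.Point.map ι.toRatAlgHom P = heegnerPointComplex Dt H →
          ∀ (Wd : WeierstrassCurve ℚ) [Wd.IsElliptic] [Wd.IsGloballyMinimal] (Cd : VariableChange ℚ),
            Cd • W.quadraticTwist (NumberField.discr K : ℚ) = Wd →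
            ∃ m : ℕ, HasTwoDivisibilityUpToTorsion W K P m ∧
              padicValNat 2 (Nat.card (AddCommGroup.primaryComponent W.sha 2)) +
                  padicValNat 2 (Nat.card (AddCommGroup.primaryComponent Wd.sha 2)) +
                  transpCount W (NumberField.discr K) + 2 * identCount W (NumberField.discr K) + 2 * padicValInt 2 Dt.c ≤
                2 * m + (if W.Δ < 0 then 1 else 0) := by
  intro W _ _ _ hCM hsurj hT hc hr K _ _ hK hadm hLt Dt H ι P hP Wd _ _ Cd hWd
  have hmod : hasEntireLFunction_rat := hasEntireLFunction_rat_of_exists_isNewformOf hnf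
  obtain ⟨-, -, ⟨m, hm⟩, -⟩ := exists_unique_exponent_at_door hmod W hr K hK (hGZ _ W K) (hKo _ W K) hadm hLt Dt H ι P hP
  exact ⟨m, hm, hU W hCM hsurj hT hc hr K hK hadm hLt Dt H ι P hP Wd Cd hWd m hm⟩

/-- **AN-28c-L ⟹ AN-28c(≤) in the width seat's `∃ m` shape**. Conditional by design. [cite: GrossLMS1991, §2 Conj. (2.2)] -/
theorem doorLawLeC_of_doorIndexLawLowerCAtTwo
    (hGZ : ∀ (N : ℕ) [NeZero N] (W : WeierstrassCurve ℚ) (K : Type) [Field K] [NumberField K], gross_zagier N W K)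
    (hKo : ∀ (N : ℕ) [NeZero N] (W : WeierstrassCurve ℚ) (K : Type) [Field K] [NumberField K], kolyvagin N W K)
    (hnf : exists_isNewformOf) (hL : DoorIndexLawLowerCAtTwo) :
    ∀ (W : WeierstrassCurve ℚ) [W.IsElliptic] [W.IsGloballyMinimal] [NeZero (W.conductorNorm ℤ)],
      ¬ W.HasCM → (∀ n : ℕ, W.HasSurjectiveModNGaloisRep ((2 ^ n : ℕ) : ℤ)) → Odd W.torsionOrder → Odd W.tamagawaProduct →
      W.analyticRank = 1 →
      ∀ (K : Type) [Field K] [NumberField K], IsImaginaryQuadratic K → DoorAdmissible W (NumberField.discr K) →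
        (W.quadraticTwist (NumberField.discr K : ℚ)).entireLFunction 1 ≠ 0 →
        ∀ (Dt : ModularParametrizationData W (W.conductorNorm ℤ)) (H : HeegnerDatum (W.conductorNorm ℤ) (NumberField.discr K))
          (ι : K →+* ℂ) (P : (W.baseChange K).toAffine.Point),
          WeierstrassCurve.Affine.Point.map ι.toRatAlgHom P = heegnerPointComplex Dt H →
          ∀ (Wd : WeierstrassCurve ℚ) [Wd.IsElliptic] [Wd.IsGloballyMinimal] (Cd : VariableChange ℚ),
            Cd • W.quadraticTwist (NumberField.discr K : ℚ) = Wd →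
            ∃ m : ℕ, HasTwoDivisibilityUpToTorsion W K P m ∧
              2 * m + (if W.Δ < 0 then 1 else 0) ≤
                padicValNat 2 (Nat.card (AddCommGroup.primaryComponent W.sha 2)) +
                  padicValNat 2 (Nat.card (AddCommGroup.primaryComponent Wd.sha 2)) +
                  transpCount W (NumberField.discr K) + 2 * identCount W (NumberField.discr K) + 2 * padicValInt 2 Dt.c := by
  intro W _ _ _ hCM hsurj hT hc hr K _ _ hK hadm hLt Dt H ι P hP Wd _ _ Cd hWd
  have hmod : hasEntireLFunction_rat := hasEntireLFunction_rat_of_exists_isNewformOf hnf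
  obtain ⟨-, -, ⟨m, hm⟩, -⟩ := exists_unique_exponent_at_door hmod W hr K hK (hGZ _ W K) (hKo _ W K) hadm hLt Dt H ι P hP
  exact ⟨m, hm, hL W hCM hsurj hT hc hr K hK hadm hLt Dt H ι P hP Wd Cd hWd m hm⟩

/-! ### §2 The named halves give Miller's halves of `BSD₂` on the whole slice, and the fkl residue (5b) -/

/-- **AN-28c-U ⟹ THE EULER-SYSTEM HALF `ord₂ #Ш(W) ≤ ord₂ #Ш_an(W)` FOR EVERY `W` ON THE SLICE of 23715**, modulo the four primary facts and
`S_rankZeroTwin` (the width seat's `missingUpperBoundAt_two_onSlice_of_doorLawGeC` on §1). Conditional by design.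
[cite: GrossLMS1991, Thm. 1.3] [cite: Miller2011LMS, Def. 1.1] -/
theorem missingUpperBoundAt_two_onSlice_of_doorIndexLawUpperCAtTwo
    (hGZ : ∀ (N : ℕ) [NeZero N] (W : WeierstrassCurve ℚ) (K : Type) [Field K] [NumberField K], gross_zagier N W K)
    (hKo : ∀ (N : ℕ) [NeZero N] (W : WeierstrassCurve ℚ) (K : Type) [Field K] [NumberField K], kolyvagin N W K)
    (hnf : exists_isNewformOf) (hHL : HoffsteinLuo1997_exists_twist_L_one_ne_zero) (hU : DoorIndexLawUpperCAtTwo)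
    (hZ : S_rankZeroTwin) :
    ∀ (W : WeierstrassCurve ℚ) [W.IsElliptic] [W.IsGloballyMinimal], ¬ W.HasCM →
      (∀ n : ℕ, W.HasSurjectiveModNGaloisRep ((2 ^ n : ℕ) : ℤ)) → Odd W.torsionOrder → Odd W.tamagawaProduct →
      W.analyticRank = 1 → MissingUpperBoundAt W 2 :=
  missingUpperBoundAt_two_onSlice_of_doorLawGeC hGZ hKo hnf hHL (doorLawGeC_of_doorIndexLawUpperCAtTwo hGZ hKo hnf hU) hZ

/-- **AN-28c-L ⟹ THE MAIN-CONJECTURE HALF `ord₂ #Ш_an(W) ≤ ord₂ #Ш(W)` FOR EVERY `W` ON THE SLICE**, modulo the four primary facts and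
`S_rankZeroTwin`. Conditional by design. [cite: GrossLMS1991, §2 Conj. (2.2)] [cite: Miller2011LMS, Def. 1.1] -/
theorem missingLowerBoundAt_two_onSlice_of_doorIndexLawLowerCAtTwo
    (hGZ : ∀ (N : ℕ) [NeZero N] (W : WeierstrassCurve ℚ) (K : Type) [Field K] [NumberField K], gross_zagier N W K)
    (hKo : ∀ (N : ℕ) [NeZero N] (W : WeierstrassCurve ℚ) (K : Type) [Field K] [NumberField K], kolyvagin N W K)
    (hnf : exists_isNewformOf) (hHL : HoffsteinLuo1997_exists_twist_L_one_ne_zero) (hL : DoorIndexLawLowerCAtTwo)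
    (hZ : S_rankZeroTwin) :
    ∀ (W : WeierstrassCurve ℚ) [W.IsElliptic] [W.IsGloballyMinimal], ¬ W.HasCM →
      (∀ n : ℕ, W.HasSurjectiveModNGaloisRep ((2 ^ n : ℕ) : ℤ)) → Odd W.torsionOrder → Odd W.tamagawaProduct →
      W.analyticRank = 1 → MissingLowerBoundAt W 2 :=
  missingLowerBoundAt_two_onSlice_of_doorLawLeC hGZ hKo hnf hHL (doorLawLeC_of_doorIndexLawLowerCAtTwo hGZ hKo hnf hL) hZ

/-- **The old fkl line's OPEN residue (5b) `RankOneAtTwoFkl.ShaAnTwoIntegralOnBigImageSlice` BY NAME under AN-28c-U** (`#Ш_an` is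
`2`-integral on the slice), modulo the four primary facts and `S_rankZeroTwin`. Conditional by design.
[cite: GrossLMS1991, Thm. 1.3] [cite: Miller2011LMS, Def. 1.1] -/
theorem shaAnTwoIntegralOnBigImageSlice_of_doorIndexLawUpperCAtTwo
    (hGZ : ∀ (N : ℕ) [NeZero N] (W : WeierstrassCurve ℚ) (K : Type) [Field K] [NumberField K], gross_zagier N W K)
    (hKo : ∀ (N : ℕ) [NeZero N] (W : WeierstrassCurve ℚ) (K : Type) [Field K] [NumberField K], kolyvagin N W K)
    (hnf : exists_isNewformOf) (hHL : HoffsteinLuo1997_exists_twist_L_one_ne_zero) (hU : DoorIndexLawUpperCAtTwo)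
    (hZ : S_rankZeroTwin) : ShaAnTwoIntegralOnBigImageSlice :=
  shaAnTwoIntegralOnBigImageSlice_of_doorLawGeC hGZ hKo hnf hHL (doorLawGeC_of_doorIndexLawUpperCAtTwo hGZ hKo hnf hU) hZ

/-! ### §3 Losslessness on the slice: Miller's halves give back the named halves at every door datum -/

/-- **THE EULER-SYSTEM HALF ON THE SLICE ⟹ AN-28c-U** at every door datum and EVERY exponent (the width seat's per-datum iff
`missingUpperBoundAt_two_iff_doorLawGeC_at` read left to right, plus uniqueness of the exponent).  `rank E(ℚ) = 1` from the four primary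
facts (`mordellWeilRank_eq_one_of_analyticRank_eq_one_of_isGloballyMinimal`), `BSD(Wd, 2)` from `S_rankZeroTwin` (the twin is non-CM of
analytic rank `0`). Conditional by design. [cite: GrossLMS1991, Thm. 1.3] [cite: Miller2011LMS, Def. 1.1] -/
theorem doorIndexLawUpperCAtTwo_of_missingUpperBoundAt_onSlice
    (hGZ : ∀ (N : ℕ) [NeZero N] (W : WeierstrassCurve ℚ) (K : Type) [Field K] [NumberField K], gross_zagier N W K)
    (hKo : ∀ (N : ℕ) [NeZero N] (W : WeierstrassCurve ℚ) (K : Type) [Field K] [NumberField K], kolyvagin N W K)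
    (hnf : exists_isNewformOf) (hHL : HoffsteinLuo1997_exists_twist_L_one_ne_zero)
    (hUs : ∀ (W : WeierstrassCurve ℚ) [W.IsElliptic] [W.IsGloballyMinimal], ¬ W.HasCM →
      (∀ n : ℕ, W.HasSurjectiveModNGaloisRep ((2 ^ n : ℕ) : ℤ)) → Odd W.torsionOrder → Odd W.tamagawaProduct →
      W.analyticRank = 1 → MissingUpperBoundAt W 2)
    (hZ : S_rankZeroTwin) : DoorIndexLawUpperCAtTwo := by
  intro W _ _ _ hCM hsurj hT hc hr K _ _ hK hadm hLt Dt H ι P hP Wd _ _ Cd hWd m hm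
  have hmod : hasEntireLFunction_rat := hasEntireLFunction_rat_of_exists_isNewformOf hnf
  have hrk : W.mordellWeilRank = 1 := (mordellWeilRank_eq_one_of_analyticRank_eq_one_of_isGloballyMinimal hGZ hKo hnf hHL W hr).1
  have hD0 : (NumberField.discr K : ℚ) ≠ 0 := by exact_mod_cast NumberField.discr_ne_zero K
  haveI hEt : (W.quadraticTwist (NumberField.discr K : ℚ)).IsElliptic := W.isElliptic_quadraticTwist hD0
  have hCMd : ¬ Wd.HasCM := RamifiedPairUpperBound.not_hasCM_of_smul_quadraticTwist_eq hD0 hWd hCM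
  have hLd : Wd.entireLFunction 1 ≠ 0 := by rw [← hWd, entireLFunction_smul]; exact hLt
  have hrd : Wd.analyticRank = 0 := (Wd.analyticRank_eq_zero_iff_holds (hmod Wd)).2 hLd
  have hBd : BSDp Wd 2 := hZ Wd hCMd hrd
  have hHN : SatisfiesHeegnerHypothesis (W.conductorNorm ℤ) K := satisfiesHeegnerHypothesis_of_doorAdmissible W K hK hadm
  obtain ⟨m', hm', hle⟩ :=
    (missingUpperBoundAt_two_iff_doorLawGeC_at hmod doorTwistTamagawaAtTwo W hT hc hr hrk K hK (hGZ _ W K) (hKo _ W K) hadm hHN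
      hLt Dt H ι P hP Wd Cd hWd hBd).mp (hUs W hCM hsurj hT hc hr)
  obtain ⟨-, -, -, huniq⟩ := exists_unique_exponent_at_door hmod W hr K hK (hGZ _ W K) (hKo _ W K) hadm hLt Dt H ι P hP
  obtain rfl : m' = m := huniq m' m hm' hm
  exact hle

/-- **THE MAIN-CONJECTURE HALF ON THE SLICE ⟹ AN-28c-L** at every door datum and every exponent (dual of
`doorIndexLawUpperCAtTwo_of_missingUpperBoundAt_onSlice`). Conditional by design. [cite: GrossLMS1991, §2 Conj. (2.2)] [cite: Miller2011LMS, Def. 1.1] -/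
theorem doorIndexLawLowerCAtTwo_of_missingLowerBoundAt_onSlice
    (hGZ : ∀ (N : ℕ) [NeZero N] (W : WeierstrassCurve ℚ) (K : Type) [Field K] [NumberField K], gross_zagier N W K)
    (hKo : ∀ (N : ℕ) [NeZero N] (W : WeierstrassCurve ℚ) (K : Type) [Field K] [NumberField K], kolyvagin N W K)
    (hnf : exists_isNewformOf) (hHL : HoffsteinLuo1997_exists_twist_L_one_ne_zero)
    (hLs : ∀ (W : WeierstrassCurve ℚ) [W.IsElliptic] [W.IsGloballyMinimal], ¬ W.HasCM →
      (∀ n : ℕ, W.HasSurjectiveModNGaloisRep ((2 ^ n : ℕ) : ℤ)) → Odd W.torsionOrder → Odd W.tamagawaProduct →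
      W.analyticRank = 1 → MissingLowerBoundAt W 2)
    (hZ : S_rankZeroTwin) : DoorIndexLawLowerCAtTwo := by
  intro W _ _ _ hCM hsurj hT hc hr K _ _ hK hadm hLt Dt H ι P hP Wd _ _ Cd hWd m hm
  have hmod : hasEntireLFunction_rat := hasEntireLFunction_rat_of_exists_isNewformOf hnf
  have hrk : W.mordellWeilRank = 1 := (mordellWeilRank_eq_one_of_analyticRank_eq_one_of_isGloballyMinimal hGZ hKo hnf hHL W hr).1
  have hD0 : (NumberField.discr K : ℚ) ≠ 0 := by exact_mod_cast NumberField.discr_ne_zero K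
  haveI hEt : (W.quadraticTwist (NumberField.discr K : ℚ)).IsElliptic := W.isElliptic_quadraticTwist hD0
  have hCMd : ¬ Wd.HasCM := RamifiedPairUpperBound.not_hasCM_of_smul_quadraticTwist_eq hD0 hWd hCM
  have hLd : Wd.entireLFunction 1 ≠ 0 := by rw [← hWd, entireLFunction_smul]; exact hLt
  have hrd : Wd.analyticRank = 0 := (Wd.analyticRank_eq_zero_iff_holds (hmod Wd)).2 hLd
  have hBd : BSDp Wd 2 := hZ Wd hCMd hrd
  have hHN : SatisfiesHeegnerHypothesis (W.conductorNorm ℤ) K := satisfiesHeegnerHypothesis_of_doorAdmissible W K hK hadm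
  obtain ⟨m', hm', hle⟩ :=
    (missingLowerBoundAt_two_iff_doorLawLeC_at hmod doorTwistTamagawaAtTwo W hT hc hr hrk K hK (hGZ _ W K) (hKo _ W K) hadm hHN
      hLt Dt H ι P hP Wd Cd hWd hBd).mp (hLs W hCM hsurj hT hc hr)
  obtain ⟨-, -, -, huniq⟩ := exists_unique_exponent_at_door hmod W hr K hK (hGZ _ W K) (hKo _ W K) hadm hLt Dt H ι P hP
  obtain rfl : m' = m := huniq m' m hm' hm
  exact hle

/-- **AN-28c-U ⟺ THE EULER-SYSTEM HALF OF `BSD₂` ON THE WHOLE SLICE** (modulo the four primary facts and `S_rankZeroTwin`): the skeleton's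
stub `stub_doorUpperC` is exactly Miller's upper half of `BSD(E,2)` for the curves of 23715. Conditional by design.
[cite: GrossLMS1991, Thm. 1.3] [cite: Miller2011LMS, Def. 1.1] -/
theorem doorIndexLawUpperCAtTwo_iff_missingUpperBoundAt_onSlice
    (hGZ : ∀ (N : ℕ) [NeZero N] (W : WeierstrassCurve ℚ) (K : Type) [Field K] [NumberField K], gross_zagier N W K)
    (hKo : ∀ (N : ℕ) [NeZero N] (W : WeierstrassCurve ℚ) (K : Type) [Field K] [NumberField K], kolyvagin N W K)
    (hnf : exists_isNewformOf) (hHL : HoffsteinLuo1997_exists_twist_L_one_ne_zero) (hZ : S_rankZeroTwin) :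
    DoorIndexLawUpperCAtTwo ↔
      ∀ (W : WeierstrassCurve ℚ) [W.IsElliptic] [W.IsGloballyMinimal], ¬ W.HasCM →
        (∀ n : ℕ, W.HasSurjectiveModNGaloisRep ((2 ^ n : ℕ) : ℤ)) → Odd W.torsionOrder → Odd W.tamagawaProduct →
        W.analyticRank = 1 → MissingUpperBoundAt W 2 :=
  ⟨fun hU => missingUpperBoundAt_two_onSlice_of_doorIndexLawUpperCAtTwo hGZ hKo hnf hHL hU hZ,
    fun hUs => doorIndexLawUpperCAtTwo_of_missingUpperBoundAt_onSlice hGZ hKo hnf hHL hUs hZ⟩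

/-- **AN-28c-L ⟺ THE MAIN-CONJECTURE HALF OF `BSD₂` ON THE WHOLE SLICE** (modulo the four primary facts and `S_rankZeroTwin`).
Conditional by design. [cite: GrossLMS1991, §2 Conj. (2.2)] [cite: Miller2011LMS, Def. 1.1] -/
theorem doorIndexLawLowerCAtTwo_iff_missingLowerBoundAt_onSlice
    (hGZ : ∀ (N : ℕ) [NeZero N] (W : WeierstrassCurve ℚ) (K : Type) [Field K] [NumberField K], gross_zagier N W K)
    (hKo : ∀ (N : ℕ) [NeZero N] (W : WeierstrassCurve ℚ) (K : Type) [Field K] [NumberField K], kolyvagin N W K)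
    (hnf : exists_isNewformOf) (hHL : HoffsteinLuo1997_exists_twist_L_one_ne_zero) (hZ : S_rankZeroTwin) :
    DoorIndexLawLowerCAtTwo ↔
      ∀ (W : WeierstrassCurve ℚ) [W.IsElliptic] [W.IsGloballyMinimal], ¬ W.HasCM →
        (∀ n : ℕ, W.HasSurjectiveModNGaloisRep ((2 ^ n : ℕ) : ℤ)) → Odd W.torsionOrder → Odd W.tamagawaProduct →
        W.analyticRank = 1 → MissingLowerBoundAt W 2 :=
  ⟨fun hL => missingLowerBoundAt_two_onSlice_of_doorIndexLawLowerCAtTwo hGZ hKo hnf hHL hL hZ,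
    fun hLs => doorIndexLawLowerCAtTwo_of_missingLowerBoundAt_onSlice hGZ hKo hnf hHL hLs hZ⟩

end Summit.BirchSwinnertonDyer.BirchSwinnertonDyer.Theorems.RankOneAtTwoOneDoor

end
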